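import Summits.Ventures.HodgeRepro.Tier4.Line1.RotationGram
import Summits.Ventures.HodgeRepro.Tier4.Line1.WittPlane

/-!
# Tier4/Line1/LocalWitt — LINE L1: Witt for the hermitian plane over ANY field of characteristic ≠ 2 (rungs C7.1 / C7.1∞)

Blind re-derivation cell `pub-hodge-repro`, Tier 4 (README §9–§10), seat t4-L1-p4 (g2), LINE L1, rung C7 of the R-c cut
(lead g385 R-II S12860 / S13015 «L1-p4 keeps C7.1 / C7.1∞»).  The residual of C7.1 / C7.1∞ displayed by t4-L1-p1's
`exists_compact_stab_mul_of_transitive` (LocalFibration p672938) and t4-L1-p2's C7LocalWitt consumer is LOCAL WITT: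
`U(W)(k_v)` is transitive on the sphere `{x : h(x, x) = h(v₀, v₀)}` (`h(v₀, v₀) ≠ 0`).  This module proves it over an
ARBITRARY field `k` of characteristic `≠ 2` — split or non-split, isotropic or anisotropic plane — in the column picture
of t4-L1-p3's WittPlane (p670389):

* `exists_orth_anisotropic`: for `Bᵀ = B`, `det B ≠ 0`, `Omᵀ B = −B Om`, `Om² = −d`, `d ≠ 0` and an anisotropic `x`, the
  `Om`-stable `β`-orthogonal complement `K` of `x` contains an ANISOTROPIC vector.  Proof: if every vector of `K` were
  isotropic then (polarisation, `pair_eq_zero_of_isotropic`) `β ≡ 0` on `K × K`; every `z` splits as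
  `π z + (β(z,x)/α) x + (β(z,Om x)/(dα)) Om x` with `π z ∈ K` (the Gram matrix of `x, Om x` is `diag(α, dα)`), so a
  vector of `K` is `β`-orthogonal to all of `k⁴`, i.e. `x′ B = 0`, `x′ = 0` — against p3's `exists_orth_ne_zero`.
* `exists_isometry_mulVec_eq_of_det_ne_zero`: p3's `exists_isometry_mulVec_eq` with its anisotropy hypothesis `hdef`
  (which it used only for `β(x,x) ≠ 0` and `β(x′,x′) ≠ 0`) and its `¬ IsSquare (−d)` (used only for `d ≠ 0`) replaced
  by `β(x,x) ≠ 0`, `d ≠ 0`, `det B ≠ 0`: the adapted basis `S = (x, Om x, x′, Om x′)`, Gram `diag(α, dα, α′, dα′)`,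
  the coordinates `c = S⁻¹ y` of `y`, the constraint `N(λ)α + N(μ)α′ = α`, p3's `SU(2)`-type isometry `R` (`witt_isometry`,
  `witt_comm_J`), `h := S R S⁻¹`.

Nothing here says anything about the status of the Hodge conjecture for CM abelian varieties, which is NOT proved
(HC_CM is NOT proved by anyone in this repository).
-/

set_option autoImplicit false

noncomputable section

namespace Summit.Ventures.HodgeRepro.Tier4.Line1.Rot

open Matrix

variable {k : Type} [Field k] [CharZero k]

/-- polarisation: if `u`, `v` and `u + v` are all `β`-isotropic (`Bᵀ = B`, characteristic `≠ 2`) then `β(u, v) = 0`. -/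
theorem pair_eq_zero_of_isotropic {B : Matrix (Fin 4) (Fin 4) k} (hB : Bᵀ = B) {u v : Fin 4 → k}
    (hu : u ⬝ᵥ (B *ᵥ u) = 0) (hv : v ⬝ᵥ (B *ᵥ v) = 0) (huv : (u + v) ⬝ᵥ (B *ᵥ (u + v)) = 0) :
    u ⬝ᵥ (B *ᵥ v) = 0 := by
  have hvu : v ⬝ᵥ (B *ᵥ u) = u ⬝ᵥ (B *ᵥ v) := pair_comm hB v u
  simp only [mulVec_add, dotProduct_add, add_dotProduct] at huv
  have h2 : (2 : k) * (u ⬝ᵥ (B *ᵥ v)) = 0 := by linear_combination huv - hu - hv - hvu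
  rcases mul_eq_zero.mp h2 with h0 | h0
  · exact absurd h0 two_ne_zero
  · exact h0

/-- **an anisotropic vector in the complement**: for `Bᵀ = B`, `det B ≠ 0`, `Omᵀ B = -(B Om)`, `Om² = -d`, `d ≠ 0` and
an anisotropic `x`, the `Om`-stable `β`-orthogonal complement of `x` contains an anisotropic vector.  (Over a field
in which the plane is isotropic this is where `IsDefinite` is no longer available; the proof uses only `det B ≠ 0`.) -/
theorem exists_orth_anisotropic {B Om : Matrix (Fin 4) (Fin 4) k} {d : k} (hB : Bᵀ = B)
    (hherm : Omᵀ * B = -(B * Om)) (hOm : Om * Om = -(d • (1 : Matrix (Fin 4) (Fin 4) k)))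
    (hd0 : d ≠ 0) (hBdet : B.det ≠ 0) {x : Fin 4 → k} (hα : x ⬝ᵥ (B *ᵥ x) ≠ 0) :
    ∃ x' : Fin 4 → k, x' ⬝ᵥ (B *ᵥ x) = 0 ∧ x' ⬝ᵥ (B *ᵥ (Om *ᵥ x)) = 0 ∧ x' ⬝ᵥ (B *ᵥ x') ≠ 0 := by
  by_contra hcon
  push Not at hcon
  obtain ⟨x', hx'ne, h1, h2⟩ := exists_orth_ne_zero B Om x
  have hxOx : x ⬝ᵥ (B *ᵥ (Om *ᵥ x)) = 0 := pair_mulVec_self hB hherm x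
  have hOxx : (Om *ᵥ x) ⬝ᵥ (B *ᵥ x) = 0 := by rw [pair_comm hB]; exact hxOx
  have hOxOx : (Om *ᵥ x) ⬝ᵥ (B *ᵥ (Om *ᵥ x)) = d * (x ⬝ᵥ (B *ᵥ x)) :=
    pair_mulVec_mulVec hherm hOm x x
  have hdα : d * (x ⬝ᵥ (B *ᵥ x)) ≠ 0 := mul_ne_zero hd0 hα
  -- the projection onto the complement
  set π : (Fin 4 → k) → (Fin 4 → k) := fun z =>
    z - (z ⬝ᵥ (B *ᵥ x) / (x ⬝ᵥ (B *ᵥ x))) • x -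
      (z ⬝ᵥ (B *ᵥ (Om *ᵥ x)) / (d * (x ⬝ᵥ (B *ᵥ x)))) • (Om *ᵥ x) with hπdef
  have hπ1 : ∀ z, π z ⬝ᵥ (B *ᵥ x) = 0 := by
    intro z
    simp only [hπdef, sub_dotProduct, smul_dotProduct, smul_eq_mul, hOxx, mul_zero, sub_zero]
    rw [div_mul_cancel₀ _ hα, sub_self]
  have hπ2 : ∀ z, π z ⬝ᵥ (B *ᵥ (Om *ᵥ x)) = 0 := by
    intro z
    simp only [hπdef, sub_dotProduct, smul_dotProduct, smul_eq_mul, hxOx, hOxOx, mul_zero, sub_zero]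
    rw [div_mul_cancel₀ _ hdα, sub_self]
  -- a vector of the complement is orthogonal to everything
  have hall : ∀ z, x' ⬝ᵥ (B *ᵥ z) = 0 := by
    intro z
    have hz : z = π z + (z ⬝ᵥ (B *ᵥ x) / (x ⬝ᵥ (B *ᵥ x))) • x +
        (z ⬝ᵥ (B *ᵥ (Om *ᵥ x)) / (d * (x ⬝ᵥ (B *ᵥ x)))) • (Om *ᵥ x) := by
      simp only [hπdef]
      abel
    have hπz : x' ⬝ᵥ (B *ᵥ π z) = 0 := by
      apply pair_eq_zero_of_isotropic hB (hcon x' h1 h2) (hcon (π z) (hπ1 z) (hπ2 z))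
      apply hcon
      · rw [add_dotProduct, h1, hπ1, add_zero]
      · rw [add_dotProduct, h2, hπ2, add_zero]
    rw [hz, mulVec_add, mulVec_add, dotProduct_add, dotProduct_add, hπz, mulVec_smul, mulVec_smul,
      dotProduct_smul, dotProduct_smul, h1, h2, smul_zero, smul_zero, add_zero, add_zero]
  have hvB : x' ᵥ* B = 0 := by
    ext j
    have := hall (Pi.single j 1)
    rw [dotProduct_mulVec, dotProduct_single, mul_one] at this
    exact this
  have hx'0 : x' = 0 := by
    have hBu : IsUnit B.det := isUnit_iff_ne_zero.mpr hBdet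
    have := congrArg (fun w => w ᵥ* B⁻¹) hvB
    simp only [vecMul_vecMul, Matrix.mul_nonsing_inv B hBu, vecMul_one, zero_vecMul] at this
    exact this
  exact hx'ne hx'0

/-- **Witt for the plane over any field of characteristic `≠ 2`, column picture**: for `Bᵀ = B`, `det B ≠ 0`,
`Omᵀ B = -(B Om)`, `Om² = -d`, `d ≠ 0`, an anisotropic `x` and any `y` of the same norm, some `Om`-linear `B`-isometry
`h` has `h x = y`.  No anisotropy of the plane and no `¬ IsSquare (-d)`: this is p3's `exists_isometry_mulVec_eq`
(WittPlane p670389) with `hdef` replaced by `exists_orth_anisotropic`, valid at every completion of `k` — split or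
non-split, isotropic or anisotropic. -/
theorem exists_isometry_mulVec_eq_of_det_ne_zero {B Om : Matrix (Fin 4) (Fin 4) k} {d : k} (hB : Bᵀ = B)
    (hherm : Omᵀ * B = -(B * Om)) (hOm : Om * Om = -(d • (1 : Matrix (Fin 4) (Fin 4) k)))
    (hd0 : d ≠ 0) (hBdet : B.det ≠ 0)
    {x y : Fin 4 → k} (hα : x ⬝ᵥ (B *ᵥ x) ≠ 0) (hxy : x ⬝ᵥ (B *ᵥ x) = y ⬝ᵥ (B *ᵥ y)) :
    ∃ h : Matrix (Fin 4) (Fin 4) k, h * Om = Om * h ∧ hᵀ * B * h = B ∧ IsUnit h ∧ h *ᵥ x = y := by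
  obtain ⟨x', hx'x, hx'Ox, hα'⟩ := exists_orth_anisotropic hB hherm hOm hd0 hBdet hα
  have hxx' : x ⬝ᵥ (B *ᵥ x') = 0 := by rw [pair_comm hB]; exact hx'x
  have hxOx' : x ⬝ᵥ (B *ᵥ (Om *ᵥ x')) = 0 := by
    rw [← neg_eq_zero, ← pair_mulVec_left hherm, pair_comm hB]
    exact hx'Ox
  set S : Matrix (Fin 4) (Fin 4) k := Matrix.of fun i j => ![x, Om *ᵥ x, x', Om *ᵥ x'] j i with hSdef
  set G : Matrix (Fin 4) (Fin 4) k :=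
    Matrix.diagonal ![x ⬝ᵥ (B *ᵥ x), d * (x ⬝ᵥ (B *ᵥ x)), x' ⬝ᵥ (B *ᵥ x'), d * (x' ⬝ᵥ (B *ᵥ x'))]
    with hGdef
  have hG : Sᵀ * B * S = G := gram_adapted hB hherm hOm x x' hxx' hxOx'
  -- `S` is invertible: `det G = det S ^ 2 * det B ≠ 0`
  have hGdet : G.det ≠ 0 := by
    rw [hGdef, Matrix.det_diagonal, Fin.prod_univ_four]
    simp only [Matrix.cons_val_zero, Matrix.cons_val_one, Matrix.head_cons, Matrix.cons_val_two,
      Matrix.cons_val_three, Matrix.tail_cons]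
    exact mul_ne_zero (mul_ne_zero (mul_ne_zero hα (mul_ne_zero hd0 hα)) hα') (mul_ne_zero hd0 hα')
  have hSdet : IsUnit S.det := by
    rw [isUnit_iff_ne_zero]
    intro h0
    apply hGdet
    rw [← hG, Matrix.det_mul, Matrix.det_mul, Matrix.det_transpose, h0, zero_mul, zero_mul]
  have hSS : S * S⁻¹ = 1 := Matrix.mul_nonsing_inv S hSdet
  have hSS' : S⁻¹ * S = 1 := Matrix.nonsing_inv_mul S hSdet
  have hOmS : Om * S = S * Matrix.of ![![0, -d, 0, 0], ![1, 0, 0, 0], ![0, 0, 0, -d], ![0, 0, 1, 0]] :=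
    mul_adapted_eq hOm x x'
  -- the coordinates of `y`
  set c : Fin 4 → k := S⁻¹ *ᵥ y with hcdef
  have hyc : S *ᵥ c = y := by rw [hcdef, mulVec_mulVec, hSS, one_mulVec]
  -- the constraint `cᵀ G c = β(y, y) = β(x, x)`
  have hconstr : c 0 * c 0 * (x ⬝ᵥ (B *ᵥ x)) + d * (c 1 * c 1) * (x ⬝ᵥ (B *ᵥ x)) +
      c 2 * c 2 * (x' ⬝ᵥ (B *ᵥ x')) + d * (c 3 * c 3) * (x' ⬝ᵥ (B *ᵥ x')) = x ⬝ᵥ (B *ᵥ x) := by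
    have h1 : y ⬝ᵥ (B *ᵥ y) = c ⬝ᵥ (G *ᵥ c) := by
      rw [← hyc, ← hG]
      calc (S *ᵥ c) ⬝ᵥ (B *ᵥ (S *ᵥ c)) = (c ᵥ* Sᵀ) ⬝ᵥ (B *ᵥ (S *ᵥ c)) := by rw [vecMul_transpose]
        _ = c ⬝ᵥ (Sᵀ *ᵥ (B *ᵥ (S *ᵥ c))) := by rw [← dotProduct_mulVec]
        _ = c ⬝ᵥ ((Sᵀ * B * S) *ᵥ c) := by simp only [mulVec_mulVec, Matrix.mul_assoc]
    have h2 : c ⬝ᵥ (G *ᵥ c) = c 0 * c 0 * (x ⬝ᵥ (B *ᵥ x)) + d * (c 1 * c 1) * (x ⬝ᵥ (B *ᵥ x)) +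
        c 2 * c 2 * (x' ⬝ᵥ (B *ᵥ x')) + d * (c 3 * c 3) * (x' ⬝ᵥ (B *ᵥ x')) := by
      rw [hGdef, dotProduct_diagonal_mulVec]
      ring
    rw [← h2, ← h1]
    exact hxy.symm
  set ν₁ : k := -(c 2 * (x' ⬝ᵥ (B *ᵥ x'))) / (x ⬝ᵥ (B *ᵥ x)) with hν₁def
  set ν₂ : k := c 3 * (x' ⬝ᵥ (B *ᵥ x')) / (x ⬝ᵥ (B *ᵥ x)) with hν₂def
  have hν₁ : ν₁ * (x ⬝ᵥ (B *ᵥ x)) = -(c 2 * (x' ⬝ᵥ (B *ᵥ x'))) := by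
    rw [hν₁def, div_mul_cancel₀ _ hα]
  have hν₂ : ν₂ * (x ⬝ᵥ (B *ᵥ x)) = c 3 * (x' ⬝ᵥ (B *ᵥ x')) := by
    rw [hν₂def, div_mul_cancel₀ _ hα]
  set R : Matrix (Fin 4) (Fin 4) k := Matrix.of
    ![![c 0, -(d * c 1), ν₁, -(d * ν₂)], ![c 1, c 0, ν₂, ν₁], ![c 2, -(d * c 3), c 0, d * c 1],
      ![c 3, c 2, -(c 1), c 0]] with hRdef
  have hRG : Rᵀ * G * R = G := witt_isometry hα hconstr hν₁ hν₂
  have hRJ : R * Matrix.of ![![0, -d, 0, 0], ![1, 0, 0, 0], ![0, 0, 0, -d], ![0, 0, 1, 0]] =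
      Matrix.of ![![0, -d, 0, 0], ![1, 0, 0, 0], ![0, 0, 0, -d], ![0, 0, 1, 0]] * R :=
    witt_comm_J _ _ _ _ _ _ _
  have hRc : R *ᵥ Pi.single 0 1 = c := by
    rw [mulVec_single_one]
    ext i
    fin_cases i <;> simp [R]
  have hcan : ∀ X : Matrix (Fin 4) (Fin 4) k, S⁻¹ * (S * X) = X := fun X => by
    rw [← Matrix.mul_assoc, hSS', Matrix.one_mul]
  have hcanT : ∀ X : Matrix (Fin 4) (Fin 4) k, Sᵀ * (S⁻¹ᵀ * X) = X := fun X => by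
    rw [← Matrix.mul_assoc, ← Matrix.transpose_mul, hSS', Matrix.transpose_one, Matrix.one_mul]
  -- `R` is invertible: `det G = det R ^ 2 * det G`
  have hRdet : IsUnit R.det := by
    rw [isUnit_iff_ne_zero]
    intro h0
    apply hGdet
    rw [← hRG, Matrix.det_mul, Matrix.det_mul, h0, mul_zero]
  refine ⟨S * R * S⁻¹, ?_, ?_, ?_, ?_⟩
  · have hOm' : Om = S * Matrix.of ![![0, -d, 0, 0], ![1, 0, 0, 0], ![0, 0, 0, -d], ![0, 0, 1, 0]] * S⁻¹ := by
      rw [← hOmS, Matrix.mul_assoc, hSS, Matrix.mul_one]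
    rw [hOm']
    simp only [Matrix.mul_assoc, hcan]
    rw [← Matrix.mul_assoc R, hRJ, Matrix.mul_assoc]
  · have hB' : B = S⁻¹ᵀ * G * S⁻¹ := by
      rw [← hG]
      calc B = (S⁻¹ᵀ * Sᵀ) * B * (S * S⁻¹) := by
            rw [← Matrix.transpose_mul, hSS, Matrix.transpose_one, Matrix.one_mul, Matrix.mul_one]
        _ = S⁻¹ᵀ * (Sᵀ * B * S) * S⁻¹ := by simp only [Matrix.mul_assoc]
    have key : S⁻¹ᵀ * (Rᵀ * (G * (R * S⁻¹))) = S⁻¹ᵀ * (G * S⁻¹) := by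
      calc S⁻¹ᵀ * (Rᵀ * (G * (R * S⁻¹))) = S⁻¹ᵀ * ((Rᵀ * G * R) * S⁻¹) := by
            simp only [Matrix.mul_assoc]
        _ = S⁻¹ᵀ * (G * S⁻¹) := by rw [hRG]
    rw [Matrix.transpose_mul, Matrix.transpose_mul, hB']
    simp only [Matrix.mul_assoc, hcan, hcanT]
    exact key
  · exact ((Matrix.isUnit_iff_isUnit_det S).mpr hSdet).mul
      ((Matrix.isUnit_iff_isUnit_det R).mpr hRdet) |>.mul
      (Matrix.isUnit_nonsing_inv_iff.mpr ((Matrix.isUnit_iff_isUnit_det S).mpr hSdet))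
  · have hx' : S *ᵥ Pi.single 0 1 = x := by
      rw [mulVec_single_one]
      rfl
    have hSx : S⁻¹ *ᵥ x = Pi.single 0 1 := by
      rw [← hx', mulVec_mulVec, hSS', one_mulVec]
    rw [← mulVec_mulVec x (S * R) S⁻¹, hSx, ← mulVec_mulVec, hRc, hyc]

end Summit.Ventures.HodgeRepro.Tier4.Line1.Rot

end
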